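import Summits.QuantumFields.YangMills.Theorems.AllWindowsColdBoxBulkMidSandwichLocalisedBL
import Summits.QuantumFields.YangMills.Theorems.SandwichVariancePinchingCeilingRemainder

/-!
# Quartic moments of linear / affine statistics under the sandwich
# (crux idea `logconcave-core-extension` on ⟨stmt-QuantumFields-24006⟩ — toward a LOCALISED quadratic
# covariance comparison at the core constant `r_K`)

Whitened frame (`H₀ = 1`), `A ∈ C²(ℝⁿ)` with the global second-difference sandwich `(1 ± δ)|h|²`, `δ < 1`,
and the centring `∫ x_i e^{−A} = 0`.  Writing `Z = ∫e^{−A}`: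

* `pow_four_le_exp_add` : `y⁴ ≤ 24 (e^y + e^{−y})`;
* `integral_dotProduct_pow_four_le` : `∫ (x·b)⁴ e^{−A} ≤ 23 (|b|²/(1−δ))² Z` — from the sub-Gaussian
  exponential moments `expMoment_le_of_sandwich` (tilt `t = 2/σ`);
* `integral_affine_coord_pow_four_le` : `∫ (H_i·x + b_i)⁴ e^{−A} ≤ 184 (|H_i|²/(1−δ) + b_i²)² Z`;
* `integral_affine_normSq_sq_le` : `∫ |Hx + b|⁴ e^{−A} ≤ 184 (Σ_i|H_i|²/(1−δ) + |b|²)² Z` (weighted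
  Cauchy–Schwarz over the coordinates, weights `w_i = |H_i|²/(1−δ) + b_i²`);
(the off-core second moment `∫_S |Hx+b|² e^{−A} ≤ 14 W √((∫_S e^{−A}) Z)` follows by Cauchy–Schwarz in the
sequel file `…SandwichLocalisedOffCore`).

HONEST SCOPE.  Free-hands work of the LEAD seat of ⟨stmt-QuantumFields-24006⟩ (FCL lineage) on an ingredient
of an UN-TRIAGED crux idea card; classical log-concave probability.  No stub of LINE-18, no crux, rung or
summit is proved; the Yang–Mills mass gap is NOT proved by any of this.
-/

noncomputable section

namespace Summit.QuantumFields.YangMills.Theorems.SandwichVariancePinching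

open MeasureTheory Real Filter Topology Set

variable {n : ℕ}

/-! ## §1 Quartic moments of linear statistics -/

/-- `y⁴ ≤ 24 (e^y + e^{−y})`. [folklore] -/
theorem pow_four_le_exp_add (y : ℝ) : y ^ 4 ≤ 24 * (exp y + exp (-y)) := by
  have h24 : ((Nat.factorial 4 : ℕ) : ℝ) = 24 := by norm_num [Nat.factorial]
  rcases le_or_gt 0 y with hy | hy
  · have h := Real.pow_div_factorial_le_exp y hy 4
    rw [h24, div_le_iff₀ (by norm_num : (0:ℝ) < 24)] at h
    nlinarith [exp_pos (-y)]
  · have h := Real.pow_div_factorial_le_exp (-y) (neg_nonneg.mpr hy.le) 4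
    rw [h24, div_le_iff₀ (by norm_num : (0:ℝ) < 24)] at h
    have e : (-y) ^ 4 = y ^ 4 := by ring
    rw [e] at h
    nlinarith [exp_pos y]

/-- Sup-norm growth of `(x·b)⁴`. [folklore] -/
theorem abs_dotProduct_pow_four_le (b x : Fin n → ℝ) :
    |(x ⬝ᵥ b) ^ 4| ≤ (∑ i, |b i|) ^ 4 * (1 + ‖x‖) ^ 4 := by
  rw [abs_pow, ← mul_pow]
  have h := abs_dotProduct_const_le b x
  rw [pow_one] at h
  exact pow_le_pow_left₀ (abs_nonneg _) h 4

/-- **QUARTIC MOMENT OF A CENTRED LINEAR STATISTIC**: `∫ (x·b)⁴ e^{−A} ≤ 23·(|b|²/(1−δ))²·∫e^{−A}`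
(sub-Gaussian exponential moments at the tilt `t = 2/σ`, `σ² = |b|²/(1−δ)`, and `3e² ≤ 23`). [folklore] -/
theorem integral_dotProduct_pow_four_le {A : (Fin n → ℝ) → ℝ} (hA : ContDiff ℝ 2 A) {δ : ℝ} (hδ1 : δ < 1)
    (hsw : ∀ x h : Fin n → ℝ, (1 - δ) * (h ⬝ᵥ h) ≤ A (x + h) + A (x - h) - 2 * A x ∧
      A (x + h) + A (x - h) - 2 * A x ≤ (1 + δ) * (h ⬝ᵥ h))
    (hcent : ∀ i : Fin n, ∫ x, x i * exp (-A x) = 0) (b : Fin n → ℝ) :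
    ∫ x, (x ⬝ᵥ b) ^ 4 * exp (-A x) ≤ 23 * ((b ⬝ᵥ b) / (1 - δ)) ^ 2 * ∫ x, exp (-A x) := by
  have hAc : Continuous A := hA.continuous
  have hZint : Integrable fun x => exp (-A x) := by
    have := integrable_tilt hAc hδ1 hsw b 0 continuous_const (w := fun _ => (1:ℝ)) (D := 1) (k := 0)
      (by norm_num) (fun x => by simp)
    simpa using this
  have hZ0 : 0 ≤ ∫ x, exp (-A x) := integral_nonneg fun x => (exp_pos _).le
  set σ2 : ℝ := (b ⬝ᵥ b) / (1 - δ) with hσ2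
  have hbb : 0 ≤ b ⬝ᵥ b := by simpa using dotProduct_self_star_nonneg b
  have h1δ : 0 < 1 - δ := by linarith
  have hσ2nn : 0 ≤ σ2 := div_nonneg hbb h1δ.le
  -- the centring kills the mean of `x·b`
  have hmean : (∫ x, (x ⬝ᵥ b) * exp (-A x)) = 0 := by
    have h := integral_dotProduct_mul_exp_neg_eq_zero hAc hδ1 hsw hcent b
    have e : (fun x : Fin n → ℝ => (x ⬝ᵥ b) * exp (-A x)) = fun x => (b ⬝ᵥ x) * exp (-A x) := by
      funext x; rw [dotProduct_comm]
    rw [e]; exact h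
  -- integrability of the quartic moment
  have hI4 : Integrable fun x => (x ⬝ᵥ b) ^ 4 * exp (-A x) := by
    have := integrable_tilt hAc hδ1 hsw b 0 ((continuous_id.dotProduct continuous_const).pow 4)
      (w := fun x => (x ⬝ᵥ b) ^ 4) (k := 4) (by norm_num) (abs_dotProduct_pow_four_le b)
    simpa using this
  rcases hσ2nn.lt_or_eq with hpos | hzero
  · -- tilt at `t = 2/σ`
    set σ : ℝ := Real.sqrt σ2 with hσ
    have hσpos : 0 < σ := Real.sqrt_pos.mpr hpos
    have hσσ : σ ^ 2 = σ2 := Real.sq_sqrt hσ2nn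
    set t : ℝ := 2 / σ with ht
    have htpos : 0 < t := by positivity
    have ht2 : t ^ 2 / 2 * σ2 = 2 := by
      rw [ht, ← hσσ]; field_simp
    have hE : ∀ s : ℝ, s = t ∨ s = -t → (∫ x, exp (s * (x ⬝ᵥ b) - A x)) ≤ exp 2 * ∫ x, exp (-A x) := by
      intro s hs
      have h := expMoment_le_of_sandwich hA hδ1 hsw b s
      rw [hmean, zero_div, mul_zero, zero_add] at h
      have hs2 : s ^ 2 = t ^ 2 := by
        rcases hs with h | h
        · rw [h]
        · rw [h]; ring
      rw [hs2, ← hσ2, ht2] at h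
      exact h
    have hIt : ∀ s : ℝ, Integrable fun x => exp (s * (x ⬝ᵥ b) - A x) := fun s => by
      have := integrable_tilt hAc hδ1 hsw b s continuous_const (w := fun _ => (1:ℝ)) (D := 1) (k := 0)
        (by norm_num) (fun x => by simp)
      simpa using this
    -- pointwise: `(x·b)⁴ e^{−A} ≤ 24 t⁻⁴ (e^{t x·b − A} + e^{−t x·b − A})`
    have hpt : ∀ x : Fin n → ℝ, (x ⬝ᵥ b) ^ 4 * exp (-A x) ≤
        24 * t⁻¹ ^ 4 * (exp (t * (x ⬝ᵥ b) - A x) + exp (-t * (x ⬝ᵥ b) - A x)) := by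
      intro x
      have h := pow_four_le_exp_add (t * (x ⬝ᵥ b))
      have e1 : exp (t * (x ⬝ᵥ b) - A x) = exp (t * (x ⬝ᵥ b)) * exp (-A x) := by
        rw [sub_eq_add_neg, exp_add]
      have e2 : exp (-t * (x ⬝ᵥ b) - A x) = exp (-(t * (x ⬝ᵥ b))) * exp (-A x) := by
        rw [← exp_add]; congr 1; ring
      rw [e1, e2]
      have he : 0 ≤ exp (-A x) := (exp_pos _).le
      have htt : t⁻¹ ^ 4 * t ^ 4 = 1 := by rw [← mul_pow, inv_mul_cancel₀ htpos.ne', one_pow]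
      have e3 : (x ⬝ᵥ b) ^ 4 = t⁻¹ ^ 4 * (t * (x ⬝ᵥ b)) ^ 4 := by
        rw [mul_pow, ← mul_assoc, htt, one_mul]
      rw [e3]
      have h4 : 0 ≤ t⁻¹ ^ 4 := by positivity
      nlinarith [mul_le_mul_of_nonneg_left h he, mul_nonneg h4 he]
    have hrhs : Integrable fun x => 24 * t⁻¹ ^ 4 * (exp (t * (x ⬝ᵥ b) - A x) + exp (-t * (x ⬝ᵥ b) - A x)) :=
      ((hIt t).add (hIt (-t))).const_mul _
    calc ∫ x, (x ⬝ᵥ b) ^ 4 * exp (-A x)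
        ≤ ∫ x, 24 * t⁻¹ ^ 4 * (exp (t * (x ⬝ᵥ b) - A x) + exp (-t * (x ⬝ᵥ b) - A x)) :=
          integral_mono hI4 hrhs hpt
      _ = 24 * t⁻¹ ^ 4 * ((∫ x, exp (t * (x ⬝ᵥ b) - A x)) + ∫ x, exp (-t * (x ⬝ᵥ b) - A x)) := by
          rw [integral_const_mul, integral_add (hIt t) (hIt (-t))]
      _ ≤ 24 * t⁻¹ ^ 4 * (exp 2 * (∫ x, exp (-A x)) + exp 2 * ∫ x, exp (-A x)) := by
          gcongr
          · exact hE t (Or.inl rfl)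
          · exact hE (-t) (Or.inr rfl)
      _ = 3 * exp 2 * σ2 ^ 2 * ∫ x, exp (-A x) := by
          have : t⁻¹ ^ 4 = σ2 ^ 2 / 16 := by
            rw [ht, inv_div, div_pow, ← hσσ]; ring
          rw [this]; ring
      _ ≤ 23 * σ2 ^ 2 * ∫ x, exp (-A x) := by
          have he2 : exp 2 ≤ 2.7182818286 ^ 2 := by
            have h1 := Real.exp_one_lt_d9
            have : exp 2 = exp 1 ^ 2 := by rw [← exp_nat_mul]; norm_num
            rw [this]
            exact pow_le_pow_left₀ (exp_pos 1).le h1.le 2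
          have h3 : 3 * exp 2 ≤ 23 := by nlinarith
          have hσZ : 0 ≤ σ2 ^ 2 * ∫ x, exp (-A x) := mul_nonneg (sq_nonneg _) hZ0
          nlinarith
  · -- `b = 0`: the statistic vanishes identically
    have hb0 : b ⬝ᵥ b = 0 := by
      have : (b ⬝ᵥ b) / (1 - δ) = 0 := by rw [← hσ2]; exact hzero.symm
      rcases (div_eq_zero_iff.mp this) with h | h
      · exact h
      · linarith
    have hb : b = 0 := dotProduct_self_eq_zero.mp hb0
    have e : (fun x : Fin n → ℝ => (x ⬝ᵥ b) ^ 4 * exp (-A x)) = fun _ => 0 := by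
      funext x; simp [hb]
    rw [e, integral_zero, ← hzero]
    simp

/-- **QUARTIC MOMENT OF AN AFFINE COORDINATE**: `∫ (w·x + c)⁴ e^{−A} ≤ 184 (|w|²/(1−δ) + c²)² ∫e^{−A}`.
[folklore] -/
theorem integral_affine_coord_pow_four_le {A : (Fin n → ℝ) → ℝ} (hA : ContDiff ℝ 2 A) {δ : ℝ}
    (hδ1 : δ < 1)
    (hsw : ∀ x h : Fin n → ℝ, (1 - δ) * (h ⬝ᵥ h) ≤ A (x + h) + A (x - h) - 2 * A x ∧
      A (x + h) + A (x - h) - 2 * A x ≤ (1 + δ) * (h ⬝ᵥ h))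
    (hcent : ∀ i : Fin n, ∫ x, x i * exp (-A x) = 0) (w : Fin n → ℝ) (c : ℝ) :
    ∫ x, (x ⬝ᵥ w + c) ^ 4 * exp (-A x) ≤
      184 * ((w ⬝ᵥ w) / (1 - δ) + c ^ 2) ^ 2 * ∫ x, exp (-A x) := by
  have hAc : Continuous A := hA.continuous
  have hZint : Integrable fun x => exp (-A x) := by
    have := integrable_tilt hAc hδ1 hsw w 0 continuous_const (w := fun _ => (1:ℝ)) (D := 1) (k := 0)
      (by norm_num) (fun x => by simp)
    simpa using this
  have hZ0 : 0 ≤ ∫ x, exp (-A x) := integral_nonneg fun x => (exp_pos _).le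
  have hI4 : Integrable fun x => (x ⬝ᵥ w) ^ 4 * exp (-A x) := by
    have := integrable_tilt hAc hδ1 hsw w 0 ((continuous_id.dotProduct continuous_const).pow 4)
      (w := fun x => (x ⬝ᵥ w) ^ 4) (k := 4) (by norm_num) (abs_dotProduct_pow_four_le w)
    simpa using this
  -- growth of the affine quartic
  have hgrow : ∀ x : Fin n → ℝ, |(x ⬝ᵥ w + c) ^ 4| ≤ ((∑ i, |w i|) + |c|) ^ 4 * (1 + ‖x‖) ^ 4 := by
    intro x
    rw [abs_pow, ← mul_pow]
    refine pow_le_pow_left₀ (abs_nonneg _) ?_ 4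
    have h := abs_dotProduct_const_le w x
    rw [pow_one] at h
    have hx1 : (1:ℝ) ≤ 1 + ‖x‖ := by linarith [norm_nonneg x]
    calc |x ⬝ᵥ w + c| ≤ |x ⬝ᵥ w| + |c| := abs_add_le _ _
      _ ≤ (∑ i, |w i|) * (1 + ‖x‖) + |c| * (1 + ‖x‖) :=
          add_le_add h (le_mul_of_one_le_right (abs_nonneg c) hx1)
      _ = ((∑ i, |w i|) + |c|) * (1 + ‖x‖) := by ring
  have hIa : Integrable fun x => (x ⬝ᵥ w + c) ^ 4 * exp (-A x) := by
    have := integrable_tilt hAc hδ1 hsw w 0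
      (((continuous_id.dotProduct continuous_const).add continuous_const).pow 4)
      (w := fun x => (x ⬝ᵥ w + c) ^ 4) (k := 4) (by norm_num) hgrow
    simpa using this
  have hpt : ∀ x : Fin n → ℝ, (x ⬝ᵥ w + c) ^ 4 * exp (-A x) ≤
      8 * ((x ⬝ᵥ w) ^ 4 * exp (-A x)) + 8 * c ^ 4 * exp (-A x) := by
    intro x
    -- `(p + q)⁴ ≤ 8(p⁴ + q⁴)` (inlined; the tree's `Literature.Geometry.MetricEmbeddings.add_pow_four_le`)
    have h : (x ⬝ᵥ w + c) ^ 4 ≤ 8 * ((x ⬝ᵥ w) ^ 4 + c ^ 4) := by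
      nlinarith [sq_nonneg (x ⬝ᵥ w - c), sq_nonneg (x ⬝ᵥ w + c), sq_nonneg ((x ⬝ᵥ w) ^ 2 - c ^ 2),
        sq_nonneg ((x ⬝ᵥ w) * c), sq_nonneg ((x ⬝ᵥ w - c) ^ 2)]
    have he : 0 ≤ exp (-A x) := (exp_pos _).le
    nlinarith [mul_le_mul_of_nonneg_right h he]
  have h4 := integral_dotProduct_pow_four_le hA hδ1 hsw hcent w
  have hσ : 0 ≤ (w ⬝ᵥ w) / (1 - δ) :=
    div_nonneg (by simpa using dotProduct_self_star_nonneg w) (by linarith)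
  calc ∫ x, (x ⬝ᵥ w + c) ^ 4 * exp (-A x)
      ≤ ∫ x, (8 * ((x ⬝ᵥ w) ^ 4 * exp (-A x)) + 8 * c ^ 4 * exp (-A x)) :=
        integral_mono hIa ((hI4.const_mul 8).add (hZint.const_mul _)) hpt
    _ = 8 * (∫ x, (x ⬝ᵥ w) ^ 4 * exp (-A x)) + 8 * c ^ 4 * ∫ x, exp (-A x) := by
        rw [integral_add (hI4.const_mul 8) (hZint.const_mul _), integral_const_mul, integral_const_mul]
    _ ≤ 8 * (23 * ((w ⬝ᵥ w) / (1 - δ)) ^ 2 * ∫ x, exp (-A x)) + 8 * c ^ 4 * ∫ x, exp (-A x) := by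
        gcongr
    _ = (184 * ((w ⬝ᵥ w) / (1 - δ)) ^ 2 + 8 * c ^ 4) * ∫ x, exp (-A x) := by ring
    _ ≤ 184 * ((w ⬝ᵥ w) / (1 - δ) + c ^ 2) ^ 2 * ∫ x, exp (-A x) := by
        refine mul_le_mul_of_nonneg_right ?_ hZ0
        have hc2 : 0 ≤ c ^ 2 := sq_nonneg c
        nlinarith [mul_nonneg hσ hc2, sq_nonneg (c ^ 2)]

/-! ## §2 The quartic moment of `|Hx + b|²` -/

/-- Coordinates of an affine field: `(Hx + b)_i = x·H_i + b_i`. [folklore] -/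
theorem mulVec_add_apply_eq (H : Matrix (Fin n) (Fin n) ℝ) (b x : Fin n → ℝ) (i : Fin n) :
    (H.mulVec x + b) i = x ⬝ᵥ H i + b i := by
  simp [Matrix.mulVec, dotProduct_comm]

/-- **QUARTIC MOMENT OF `|Hx+b|²`** (weighted Cauchy–Schwarz over coordinates, weights
`w_i = |H_i|²/(1−δ) + b_i²`): `∫ |Hx+b|⁴ e^{−A} ≤ 184·(Σ_i |H_i|²/(1−δ) + |b|²)²·∫e^{−A}`. [folklore] -/
theorem integral_affine_normSq_sq_le {A : (Fin n → ℝ) → ℝ} (hA : ContDiff ℝ 2 A) {δ : ℝ} (hδ1 : δ < 1)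
    (hsw : ∀ x h : Fin n → ℝ, (1 - δ) * (h ⬝ᵥ h) ≤ A (x + h) + A (x - h) - 2 * A x ∧
      A (x + h) + A (x - h) - 2 * A x ≤ (1 + δ) * (h ⬝ᵥ h))
    (hcent : ∀ i : Fin n, ∫ x, x i * exp (-A x) = 0) (H : Matrix (Fin n) (Fin n) ℝ) (b : Fin n → ℝ) :
    ∫ x, ((H.mulVec x + b) ⬝ᵥ (H.mulVec x + b)) ^ 2 * exp (-A x) ≤
      184 * ((∑ i, H i ⬝ᵥ H i) / (1 - δ) + b ⬝ᵥ b) ^ 2 * ∫ x, exp (-A x) := by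
  have hAc : Continuous A := hA.continuous
  obtain ⟨C₀, κ, _, hκ, hlb⟩ := exists_quadratic_lower_of_sandwich hAc hδ1 hsw
  have hZint : Integrable fun x => exp (-A x) := by
    have := integrable_mul_exp_neg_of_growth hAc continuous_const hκ (by norm_num : 0 ≤ 8) hlb
      (w := fun _ => (1:ℝ)) (D := 1) (fun x => by simp)
    simpa using this
  have hZ0 : 0 ≤ ∫ x, exp (-A x) := integral_nonneg fun x => (exp_pos _).le
  have h1δ : 0 < 1 - δ := by linarith
  -- weights
  set w : Fin n → ℝ := fun i => (H i ⬝ᵥ H i) / (1 - δ) + b i ^ 2 with hw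
  have hw0 : ∀ i, 0 ≤ w i := fun i =>
    add_nonneg (div_nonneg (by simpa using dotProduct_self_star_nonneg (H i)) h1δ.le) (sq_nonneg _)
  have hwzero : ∀ i, w i = 0 → ∀ x : Fin n → ℝ, (H.mulVec x + b) i = 0 := by
    intro i hi x
    have hH0 : H i ⬝ᵥ H i = 0 := by
      have h1 : 0 ≤ (H i ⬝ᵥ H i) / (1 - δ) :=
        div_nonneg (by simpa using dotProduct_self_star_nonneg (H i)) h1δ.le
      have h2 : (H i ⬝ᵥ H i) / (1 - δ) = 0 := by
        have := sq_nonneg (b i); simp only [hw] at hi; linarith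
      rcases div_eq_zero_iff.mp h2 with h | h
      · exact h
      · linarith
    have hHi : H i = 0 := dotProduct_self_eq_zero.mp hH0
    have hbi : b i = 0 := by
      have : b i ^ 2 = 0 := by simp only [hw, hH0, zero_div, zero_add] at hi; exact hi
      exact pow_eq_zero_iff (two_ne_zero) |>.mp this
    rw [mulVec_add_apply_eq, hHi, hbi]; simp
  set W : ℝ := ∑ i, w i with hW
  have hWeq : W = (∑ i, H i ⬝ᵥ H i) / (1 - δ) + b ⬝ᵥ b := by
    simp only [hW, hw, Finset.sum_add_distrib, Finset.sum_div, dotProduct, sq]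
  -- pointwise weighted Cauchy–Schwarz: `|u|⁴ ≤ W · Σ_i u_i⁴ / w_i`
  have hpt : ∀ x : Fin n → ℝ, ((H.mulVec x + b) ⬝ᵥ (H.mulVec x + b)) ^ 2 ≤
      W * ∑ i, (H.mulVec x + b) i ^ 4 / w i := by
    intro x
    set u := H.mulVec x + b with hu
    have e : u ⬝ᵥ u = ∑ i, u i ^ 2 := by simp [dotProduct, sq]
    rw [e, hW]
    refine Finset.sum_sq_le_sum_mul_sum_of_sq_le_mul Finset.univ (fun i _ => hw0 i)
      (fun i _ => div_nonneg (by positivity) (hw0 i)) (fun i _ => ?_)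
    rcases (hw0 i).lt_or_eq with hpos | hz
    · rw [mul_div_cancel₀ _ hpos.ne']; ring_nf; rfl
    · have : u i = 0 := hwzero i hz.symm x
      rw [this]; simp
  -- integrability of the coordinate quartics and of `|u|⁴`
  have hIi : ∀ i, Integrable fun x => (H.mulVec x + b) i ^ 4 * exp (-A x) := by
    intro i
    have h := integrable_tilt hAc hδ1 hsw (H i) 0
      (((continuous_id.dotProduct continuous_const).add continuous_const).pow 4)
      (w := fun x => (x ⬝ᵥ H i + b i) ^ 4) (D := ((∑ j, |H i j|) + |b i|) ^ 4) (k := 4) (by norm_num) ?_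
    · refine (by simpa using h : Integrable fun x => (x ⬝ᵥ H i + b i) ^ 4 * exp (-A x)).congr
        (ae_of_all _ fun x => ?_)
      simp only [mulVec_add_apply_eq]
    · intro x
      rw [abs_pow, ← mul_pow]
      refine pow_le_pow_left₀ (abs_nonneg _) ?_ 4
      have h := abs_dotProduct_const_le (H i) x
      rw [pow_one] at h
      have hx1 : (1:ℝ) ≤ 1 + ‖x‖ := by linarith [norm_nonneg x]
      calc |x ⬝ᵥ H i + b i| ≤ |x ⬝ᵥ H i| + |b i| := abs_add_le _ _
        _ ≤ (∑ j, |H i j|) * (1 + ‖x‖) + |b i| * (1 + ‖x‖) :=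
            add_le_add h (le_mul_of_one_le_right (abs_nonneg _) hx1)
        _ = ((∑ j, |H i j|) + |b i|) * (1 + ‖x‖) := by ring
  obtain ⟨Cu, hCu0, hCu⟩ := exists_norm_affine_le H b
  have hn : (0:ℝ) ≤ n := Nat.cast_nonneg n
  have hIuu : Integrable fun x => ((H.mulVec x + b) ⬝ᵥ (H.mulVec x + b)) ^ 2 * exp (-A x) := by
    refine integrable_mul_exp_neg_of_growth hAc ((((contDiff_affine H b).continuous).dotProduct
      (contDiff_affine H b).continuous).pow 2) hκ (by norm_num : 4 ≤ 8) hlb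
      (D := ((n : ℝ) * Cu ^ 2) ^ 2) fun x => ?_
    have h0 : 0 ≤ (H.mulVec x + b) ⬝ᵥ (H.mulVec x + b) := by
      simpa using dotProduct_self_star_nonneg (H.mulVec x + b)
    rw [abs_of_nonneg (sq_nonneg _)]
    have h1 : (H.mulVec x + b) ⬝ᵥ (H.mulVec x + b) ≤ (n : ℝ) * Cu ^ 2 * (1 + ‖x‖) ^ 2 := by
      have huub : ‖H.mulVec x + b‖ ^ 2 ≤ Cu ^ 2 * (1 + ‖x‖) ^ 2 := by
        rw [← mul_pow]; exact pow_le_pow_left₀ (norm_nonneg _) (hCu x) 2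
      nlinarith [dotProduct_self_le_card_mul_norm_sq (H.mulVec x + b), mul_le_mul_of_nonneg_left huub hn]
    calc ((H.mulVec x + b) ⬝ᵥ (H.mulVec x + b)) ^ 2 ≤ ((n : ℝ) * Cu ^ 2 * (1 + ‖x‖) ^ 2) ^ 2 :=
          pow_le_pow_left₀ h0 h1 2
      _ = ((n : ℝ) * Cu ^ 2) ^ 2 * (1 + ‖x‖) ^ 4 := by ring
  -- integrate
  have hsumI : Integrable fun x => W * ∑ i, (H.mulVec x + b) i ^ 4 / w i * exp (-A x) := by
    refine (integrable_finsetSum _ fun i _ => ?_).const_mul W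
    have := (hIi i).div_const (w i)
    refine this.congr (ae_of_all _ fun x => ?_)
    simp only; ring
  have hcoord : ∀ i, ∫ x, (H.mulVec x + b) i ^ 4 * exp (-A x) ≤ 184 * w i ^ 2 * ∫ x, exp (-A x) := by
    intro i
    have h := integral_affine_coord_pow_four_le hA hδ1 hsw hcent (H i) (b i)
    have e : (fun x => (H.mulVec x + b) i ^ 4 * exp (-A x)) = fun x => (x ⬝ᵥ H i + b i) ^ 4 * exp (-A x) := by
      funext x; rw [mulVec_add_apply_eq]
    rw [e]
    simpa [hw] using h
  calc ∫ x, ((H.mulVec x + b) ⬝ᵥ (H.mulVec x + b)) ^ 2 * exp (-A x)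
      ≤ ∫ x, W * ∑ i, (H.mulVec x + b) i ^ 4 / w i * exp (-A x) := by
        refine integral_mono hIuu hsumI fun x => ?_
        have h := hpt x
        have he : 0 ≤ exp (-A x) := (exp_pos _).le
        have := mul_le_mul_of_nonneg_right h he
        simpa [Finset.sum_mul, Finset.mul_sum, mul_assoc] using this
    _ = W * ∑ i, (∫ x, (H.mulVec x + b) i ^ 4 * exp (-A x)) / w i := by
        rw [integral_const_mul, integral_finsetSum _ (fun i _ => ?_)]
        · congr 1
          refine Finset.sum_congr rfl fun i _ => ?_
          have e : (fun x => (H.mulVec x + b) i ^ 4 / w i * exp (-A x)) =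
              fun x => ((H.mulVec x + b) i ^ 4 * exp (-A x)) / w i := by funext x; ring
          rw [e, integral_div]
        · have := (hIi i).div_const (w i)
          refine this.congr (ae_of_all _ fun x => ?_)
          simp only; ring
    _ ≤ W * ∑ i, (184 * w i * ∫ x, exp (-A x)) := by
        refine mul_le_mul_of_nonneg_left (Finset.sum_le_sum fun i _ => ?_) (Finset.sum_nonneg fun i _ => hw0 i)
        rcases (hw0 i).lt_or_eq with hpos | hz
        · rw [div_le_iff₀ hpos]
          calc ∫ x, (H.mulVec x + b) i ^ 4 * exp (-A x) ≤ 184 * w i ^ 2 * ∫ x, exp (-A x) := hcoord i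
            _ = 184 * w i * (∫ x, exp (-A x)) * w i := by ring
        · have e : (fun x => (H.mulVec x + b) i ^ 4 * exp (-A x)) = fun _ => 0 := by
            funext x; rw [hwzero i hz.symm x]; simp
          rw [e, integral_zero, zero_div, ← hz]; simp
    _ = 184 * ((∑ i, H i ⬝ᵥ H i) / (1 - δ) + b ⬝ᵥ b) ^ 2 * ∫ x, exp (-A x) := by
        rw [← hWeq, ← Finset.sum_mul, ← Finset.mul_sum, ← hW]; ring

end Summit.QuantumFields.YangMills.Theorems.SandwichVariancePinching

end
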